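import Summits.ABC.IUTFork.Repair.RHQ3LTailUniformWitnessPow
import Summits.ABC.IUTFork.Repair.RHQ3LTailUniformRefutation
import Summits.ABC.IUTFork.Repair.RHQ3LTailConverse
import HarnessLib

/-!
# D-0079 RESCUE sub-cell R-H, ROUND 2 Q3 — «NOT UNIFORMLY» FOR ROW 3 (Σ₃), UNCONDITIONALLY: no single level `l₀` puts the `K`-level pilot
# datum of every genuine [IUTchI] Def. 3.1 datum of level `l ≥ l₀` inside Σ₃ (seat abc-iut-rh2-q3-typ-1 g3)

PROOF-ONLY file (D-0012; 0 definitions, 0 `Prop` facts, no instance, no notation). Rung LADDER-ABC:A2.RESCUE.H, director charge (10) «type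
`∃ l₀, ∀ l ≥ l₀, every genuine admissible datum lies in Σ_row` per kept row — prove or refute». ROW 3 (Σ₃ = truth set of the typed hull-capacity
hypothesis H⋆₃ = `RHHullCapacityNecessaryTyped.HStar`): the per-CURVE reading `RH.Q3LTail.LTailSigma3 F E` is PROVED (g0, p470687, `l₀(E)`
exponential in the local heights); here the UNIFORM reading is REFUTED with no hypothesis — **`not_exists_uniform_l0_hStar`**:
`¬ ∃ l₀, ∀ l ≥ l₀, ∀ (F, E, K, F̄, Pb) (D : InitialThetaData F K F̄ E l Pb) (logv) (hlog : LogvAnalytic logv), HStar (pilotDataOfK D K) hlog`.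
Same engine as the row-8 file `RHQ3LTailUniformRefutation` (p489180) with a deeper pole: the witness is `λ_{r,32} = r³²/(r³²+1)`
(`RHQ3LTailUniformWitnessPow`: pole of order `64` at `r`, admissible, (P2) for `l > 64` with `r³² + 1 < 3^l`, (P5)), at a prime `l ≡ 3 (mod 4)`,
`l ≥ 2560` (Dirichlet) and a prime `r ∈ (30l, 60l]` (Bertrand):
* §1 **(P6)** at `(ratPoint λ_{r,n}, l)` for `4 ∣ n` (`rⁿ ≡ 1 (mod 5)`, so `E₁ mod 5 = [0,4,0,3,0]`, `a₅ = 2`, certificate `(X−1)² + 4` rootless iff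
  `l ≡ 3 (4)` — the row-8 file's `natCard_point_five` / `noroot_of_mod_four` reused BY NAME; multiplicative `q = r`, `ord_r Δ(E₁) = 2n`, `l ∤ 2n`),
  by abc-iut-w6-d102's `FreyP6Engine.condP6_ratPoint_of_certificate` (p477940);
* §2 **OUT OF Σ₃** (`not_hStar_ratPoint_of_pole`): at ANY genuine Θ-volume datum over a rational point with a pole prime `p > 30·l`, `p ∉ {2,3,5,l}`,
  of order `h` with `56·l ≤ (l−3)·h`: `[K:ℚ] ≤ 184320·l⁴ ≤ p⁴` (abc-iut-w5-d194 `finrank_rat_K_le_ratPoint`, [IUTchIV] Thm. 1.10 Step (ii)), so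
  `6 + 2·log_p[K:ℚ] ≤ 14`, and `ord_v(q_v) = h·e(v|p)` at the bad place `x₀ ∣ p` of abc-iut-c312-7's `GenuineK.exists_bad_tame_place_of_ord_neg`
  ([IUTchI] Def. 3.1 (b)), whence g0's converse `RH.Q3LTail.not_hStar_pilotDataOfK_of_heavy_top` (p472523: `4l·e(v|p)·(6 + 2log_p[K:ℚ]) ≤ (l−3)·ord_v(q_v)`
  ⟹ `¬ H⋆₃`, [IUTchIV] Prop. 1.2/1.3);
* §3 the assembly (Dirichlet, Bertrand, `ThetaPartII.stub_thetaData` = [IUTchIV] Cor. 2.2 (ii) proof (P7)).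
READING (numbers, no side): with `lTailSigma3_holds` this is «Q3 3: YES PER CURVE, NOT UNIFORMLY» with BOTH halves theorems. Nothing here asserts abc
or takes a side on [IUTchIII] Cor. 3.12 or on any author; H⋆₃ is row 3's HYPOTHESIS vocabulary, a statement about OUR typed objects; refuted-as-typed
≠ refuted-in-print; typed ≠ proved.
[cite: Mochizuki2012, IUTchI Def. 3.1 (b)(c) pp. 61–62, Ex. 3.2 (iv) p. 71; IUTchIV Prop. 1.2 (i)(ii) p. 10, Prop. 1.3 p. 12, Thm. 1.10 Steps (ii)–(iii)
pp. 24–26, Cor. 2.2 (ii) proof (P2)(P5)(P6)(P7) pp. 45–46] [cite: Mazur1978, §6 Prop. 6.3 (1) p. 153] [cite: MochizukiGenEll2010, Lem. 3.1 (iii) p. 14]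
[cite: SilvermanAEC2009, III.1 Prop. 1.7(b), VII.5 Prop. 5.1(b)] [cite: NeukirchANT1999, Ch. II Prop. (6.8)] [claim: Mochizuki2012, status: disputed] for every IUT locution.
-/

noncomputable section

open Set Function NumberField IsDedekindDomain Module

namespace Summit.ABC.IUTFork.Repair.RH.Q3LTailSigma8

open Literature.IUT.LogThetaLattice Literature.IUT.LogVolume Literature.IUT.HodgeTheaters
open Literature.IUT.LogVolume.ThetaData Literature.IUT.LogVolume.Cor22
open Summit.ABC.IUTFork.Thm311 Summit.ABC.IUTFork.Thm311.Real Summit.ABC.IUTFork.Cor312Prov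
open Literature.NumberTheory.NumberFields Literature.NumberTheory.DiophantineGeometry
  Literature.NumberTheory.DiophantineGeometry.GenEll Literature.NumberTheory.DiophantineGeometry.UniformABCConjecture
  Rat.HeightOneSpectrum Summit.ABC.ABC.Theorems Summit.ABC.IUTFork.Conditional
open Summit.ABC.IUTFork.Repair.RHHullCapacityNecessaryTyped Summit.ABC.IUTFork.Repair.RH.Q3LTail

namespace UniformWitnessPow

/-! ## §1. (P6) at `(ratPoint λ_{r,n}, l)` for `4 ∣ n`, `l ≡ 3 (mod 4)` -/

section P6

open Literature.NumberTheory.EllipticCurves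

variable (r n : ℕ)

/-- `xⁿ = 1` for every nonzero `x ∈ 𝔽₅` and `4 ∣ n` (Fermat), at `x = r mod 5`. [folklore] -/
theorem zmod_five_pow {r n : ℕ} (hr5 : ¬ 5 ∣ r) (hn : 4 ∣ n) : (r : ZMod 5) ^ n = 1 := by
  have hr0 : (r : ZMod 5) ≠ 0 := fun h => hr5 ((ZMod.natCast_eq_zero_iff r 5).1 h)
  have key : ∀ x : ZMod 5, x ≠ 0 → x ^ 4 = 1 := by decide
  obtain ⟨m, rfl⟩ := hn
  rw [pow_mul, key _ hr0, one_pow]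

/-- `E₁ mod 5 = [0, 4, 0, 3, 0]` for every `r` prime to `5` and `4 ∣ n` (`a = rⁿ ≡ 1`, `c = rⁿ + 1 ≡ 2 (mod 5)`). [folklore] -/
theorem model_map_five (hr5 : ¬ 5 ∣ r) (hn : 4 ∣ n) :
    (⟨0, -(((r ^ n + 1 : ℕ) : ℤ) ^ 2 + (r ^ n : ℕ) * (r ^ n + 1 : ℕ)), 0, ((r ^ n : ℕ) : ℤ) * ((r ^ n + 1 : ℕ) : ℤ) ^ 3, 0⟩ :
      WeierstrassCurve ℤ).map (Int.castRingHom (ZMod 5)) = ⟨0, 4, 0, 3, 0⟩ := by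
  have h1 := zmod_five_pow hr5 hn
  ext
  · simp
  · simp only [WeierstrassCurve.map_a₂, Int.coe_castRingHom]; push_cast; rw [h1]; decide
  · simp
  · simp only [WeierstrassCurve.map_a₄, Int.coe_castRingHom]; push_cast; rw [h1]; decide
  · simp

/-- **`a₅(E₁) = 5 + 1 − 4 = 2`** for every `r` prime to `5` and `4 ∣ n` (kernel count `natCard_point_five` of the row-8 file). [cite: SilvermanAEC2009, V.2] -/
theorem frobeniusTrace_five (hr5 : ¬ 5 ∣ r) (hn : 4 ∣ n) :
    Literature.NumberTheory.Automorphic.frobeniusTrace (⟨0, -(((r ^ n + 1 : ℕ) : ℤ) ^ 2 + (r ^ n : ℕ) * (r ^ n + 1 : ℕ)), 0,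
      ((r ^ n : ℕ) : ℤ) * ((r ^ n + 1 : ℕ) : ℤ) ^ 3, 0⟩ : WeierstrassCurve ℤ) 5 = 2 := by
  rw [Literature.NumberTheory.Automorphic.frobeniusTrace, Literature.NumberTheory.Automorphic.numPointsMod, model_map_five r n hr5 hn,
    UniformWitness.natCard_point_five]; norm_num

/-- `5 ∤ Δ(E₁) = 16·a²·c⁸·(c−a)²` (`a = rⁿ ≡ 1`, `c ≡ 2`, `c − a = 1`: `Δ ≡ 16·2⁸ ≡ 1 (mod 5)`). [folklore] -/
theorem five_not_dvd_disc (hr5 : ¬ 5 ∣ r) (hn : 4 ∣ n) :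
    ¬ ((5 : ℕ) : ℤ) ∣ 16 * ((r ^ n : ℕ) : ℤ) ^ 2 * ((r ^ n + 1 : ℕ) : ℤ) ^ 8 * (((r ^ n + 1 : ℕ) : ℤ) - (r ^ n : ℕ)) ^ 2 := by
  have h1 := zmod_five_pow hr5 hn
  intro h
  have h0 := (ZMod.intCast_zmod_eq_zero_iff_dvd _ 5).2 h
  push_cast at h0
  rw [h1] at h0
  exact absurd h0 (by decide)

/-- **(P6) at `(ratPoint λ_{r,n}, l)`** for primes `r ∉ {2, 5, l}`, `l ≥ 7`, `l ≡ 3 (mod 4)`, `l ∤ 2n`, and `4 ∣ n` — the engine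
`FreyP6Engine.condP6_ratPoint_of_certificate` (p477940) with the good prime `5` (`a₅ = 2`, certificate rootless by `l ≡ 3 (4)`,
`UniformWitness.noroot_of_mod_four`) and the multiplicative prime `q = r` (`r ∤ c₄ ≡ 16`, `Δ(E₁) = r²ⁿ·16(rⁿ+1)⁸`).
[cite: Mochizuki2012, IUTchIV Cor. 2.2 (ii) proof (P6) p. 46] [cite: Mazur1978, §6 Prop. 6.3 (1) p. 153] [cite: MochizukiGenEll2010, Lem. 3.1 (iii) p. 14]
[claim: Mochizuki2012, status: disputed] -/
theorem condP6 (hr : r.Prime) (hr2 : r ≠ 2) (hr5 : r ≠ 5) (hn : 1 ≤ n) (hn4 : 4 ∣ n) {l : ℕ} (hl : l.Prime) (hl7 : 7 ≤ l) (hmod : l % 4 = 3)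
    (hrl : r ≠ l) (hln : ¬ l ∣ 2 * n) :
    CondP6 (ratPoint (((r ^ n : ℕ) : ℚ) / ((r ^ n + 1 : ℕ) : ℚ))) l := by
  haveI : Fact l.Prime := ⟨hl⟩
  haveI : Fact (Nat.Prime 5) := ⟨by norm_num⟩
  haveI : NeZero r := ⟨hr.ne_zero⟩
  have hr5' : ¬ 5 ∣ r := fun h => hr5 ((Nat.prime_dvd_prime_iff_eq (by norm_num) hr).1 h).symm
  have hrr : (r : ZMod r) ^ n = 0 := by rw [ZMod.natCast_self]; exact zero_pow (by omega)
  refine FreyP6Engine.condP6_ratPoint_of_certificate (r ^ n) (r ^ n + 1) (pow_ne_zero _ hr.ne_zero) (Nat.succ_ne_zero _)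
    (Nat.lt_succ_self _).ne l (FreyRef.not_dvd_46080_of_seven_le hl hl7) 5 (by omega) ?_ ?_ r hr ?_ ?_ (2 * n) (by omega) hln
    (16 * ((r ^ n + 1 : ℕ) : ℤ) ^ 8) ?_ ?_
  · rw [FreyP6Engine.Δ_model]
    exact five_not_dvd_disc r n hr5' hn4
  · intro t
    rw [frobeniusTrace_five r n hr5' hn4]
    push_cast
    exact UniformWitness.noroot_of_mod_four hl hmod t
  · exact fun h => hrl ((Nat.prime_dvd_prime_iff_eq hr hl).1 h)
  · rw [FreyP6Engine.c₄_model]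
    intro h
    have h0 := (ZMod.intCast_zmod_eq_zero_iff_dvd _ r).2 h
    push_cast at h0
    rw [hrr] at h0
    simp only [zero_add, one_pow, mul_one, sub_zero, add_zero, ne_eq, OfNat.ofNat_ne_zero, not_false_eq_true, zero_pow] at h0
    exact UniformWitness.sixteen_ne_zero r hr hr2 h0
  · rw [FreyP6Engine.Δ_model]; push_cast; ring
  · intro h
    have h0 := (ZMod.intCast_zmod_eq_zero_iff_dvd _ r).2 h
    push_cast at h0
    rw [hrr] at h0
    simp only [zero_add, one_pow, mul_one] at h0
    exact UniformWitness.sixteen_ne_zero r hr hr2 h0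

end P6

/-! ## §2. Every genuine Θ-volume datum over a rational point with a deep pole prime `p > 30·l` is OUTSIDE Σ₃ -/

section Out

/-- **OUT OF Σ₃ AT A RATIONAL POINT WITH A DEEP, LARGE POLE PRIME.** `λ ∈ ℚ`, `T` a genuine Θ-volume datum at `(ratPoint λ, l)` (`l` prime),
`p ∉ {2, 3, 5, l}` a prime with **`30·l < p`** at which `j(λ)` has a pole of exact order `h ≥ 1` with **`56·l ≤ (l − 3)·h`** ⟹ the `K`-level pilot
datum is OUTSIDE Σ₃ for EVERY analytic logarithm family: `¬ HStar (pilotDataOfK T.D T.K) hlog`. At the bad place `x₀ ∣ p` of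
`GenuineK.exists_bad_tame_place_of_ord_neg`: `ord_v(q_v) = h·e(v|p)`; `[K:ℚ] ≤ 184320·l⁴ ≤ p⁴` (`finrank_rat_K_le_ratPoint`) so `6 + 2·log_p[K:ℚ] ≤ 14`;
then g0's `not_hStar_pilotDataOfK_of_heavy_top` (p472523). [cite: Mochizuki2012, IUTchI Def. 3.1 (b)(c) pp. 61–62; IUTchIV Prop. 1.2 p. 10,
Prop. 1.3 p. 12, Thm. 1.10 Step (ii) p. 24] [claim: Mochizuki2012, status: disputed] -/
theorem not_hStar_ratPoint_of_pole {q : ℚ} {l : ℕ} (T : ThetaVolumeDatumAt (ratPoint q) l) (hP : ratPoint q ∈ UP) (hl : l.Prime)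
    (pp : Nat.Primes) (hp2 : (pp : ℕ) ≠ 2) (hp3 : (pp : ℕ) ≠ 3) (hp5 : (pp : ℕ) ≠ 5) (hpl : (pp : ℕ) ≠ l) (h30 : 30 * l < (pp : ℕ))
    {h : ℕ} (hh : 0 < h) (hord : ∀ u : HeightOneSpectrum (𝓞 ℚ), natGenerator u = (pp : ℕ) → ord ℚ u (jInv q) = -(h : ℤ))
    (hineq : 56 * l ≤ (l - 3) * h) :
    letI := T.instFieldF; letI := T.instNumberFieldF; letI := T.instAlgebraF; letI := T.instFieldK
    letI := T.instNumberFieldK; letI := T.instAlgebraK; letI := T.instFieldFbar; letI := T.instAlgebraFbar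
    letI := T.instAlgebraKFbar; letI := T.instIsElliptic
    ∀ (logv : PadicLogs T.K) (hlog : LogvAnalytic logv), ¬ HStar (pilotDataOfK T.D T.K) hlog := by
  letI := T.instFieldF; letI := T.instNumberFieldF; letI := T.instAlgebraF; letI := T.instFieldK
  letI := T.instNumberFieldK; letI := T.instAlgebraK; letI := T.instFieldFbar; letI := T.instAlgebraFbar
  letI := T.instAlgebraKFbar; letI := T.instIsElliptic
  intro logv hlog
  haveI : Fact (pp : ℕ).Prime := ⟨pp.2⟩
  have hl5 : 5 ≤ l := T.D.five_le_l
  -- the place `v₀` of `ℚ` over `p`: pole of order `h`, `e(v₀|p) = 1`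
  set v₀ : HeightOneSpectrum (𝓞 ℚ) := (primesEquiv (R := 𝓞 ℚ)).symm ⟨pp.1, pp.2⟩ with hv₀def
  have hgen : natGenerator v₀ = (pp : ℕ) := UniformWitness.natGenerator_primesEquiv_symm pp.1 pp.2
  have hv₀ : ((pp : ℕ) : 𝓞 ℚ) ∈ v₀.asIdeal := FreyP6Engine.natCast_mem_asIdeal pp.1 pp.2
  have hram₀ : ramIdx ℚ v₀ = 1 := by
    rw [ramIdx_eq]; exact Literature.NumberTheory.EllipticCurves.Fisher2016.ramificationIdx_int_rat_eq_one v₀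
  have hv₀e : ¬ (pp : ℕ) ∣ ramIdx ℚ v₀ := by rw [hram₀]; exact pp.2.not_dvd_one
  have hm : ord ℚ v₀ (jInv q) = -(h : ℤ) := hord v₀ hgen
  -- a BAD place `x₀ ∣ p` of the `K`-level pilot datum
  obtain ⟨x₀, hx₀S, -, -, -⟩ := GenuineK.exists_bad_tame_place_of_ord_neg T hP hl pp hp2 hp3 hp5 hpl v₀ hv₀ hv₀e hm hh
  set w := placeOf (pilotDataOfK T.D T.K) pp.1 x₀ with hwdef
  set v := finBelow T.F T.K w with hvdef
  set u₀ := finBelow (ratPoint q).F T.F v with hu₀def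
  have hw_under : w.under (𝓞 T.F) = v := rfl
  have hv_under : v.under (𝓞 (ratPoint q).F) = u₀ := rfl
  obtain ⟨u₁, hu₁⟩ : ∃ u₁ : HeightOneSpectrum (𝓞 ℚ), u₁ = finBelow (ratPoint q).F T.F v := ⟨_, rfl⟩
  have hu₁gen : natGenerator u₁ = (pp : ℕ) :=
    GenuineK.natGenerator_eq_of_eq_finBelow_placeOf T pp x₀ u₁ (by rw [hu₁, hvdef, hwdef])
  have hordu₀ : Literature.IUT.LogVolume.ord (ratPoint q).F (finBelow (ratPoint q).F T.F v) (jInv (ratPoint q).x) = -(h : ℤ) := by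
    have := hord u₁ hu₁gen
    rw [hu₁] at this
    exact this
  -- `v ∈ 𝕍(F)^bad`, `ord_v(q_v) = h·e(v|u₀)`
  have hvVFbad : FinitePlace.mk v ∈ T.D.VFbad := (mem_pilotDataOfK_S_iff T.D T.K w).mp hx₀S
  have hq : (qParamOrd T.E v : ℤ) = (Ideal.ramificationIdx' u₀.asIdeal v.asIdeal : ℤ) * h := by
    have h1 := ThetaData.neg_ord_j_eq_ramificationIdx_mul_qParamOrd_of_under_mem_VFbad T.D (w := w)
      (by rw [hw_under]; exact hvVFbad)
    rw [hw_under] at h1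
    have h2 : Literature.IUT.LogVolume.ord T.K w (algebraMap T.F T.K T.E.j) =
        (Ideal.ramificationIdx' v.asIdeal w.asIdeal : ℤ) * ((Ideal.ramificationIdx' u₀.asIdeal v.asIdeal : ℤ) * (-(h : ℤ))) := by
      rw [Cor22.ord_algebraMap_eq w, T.j_eq, Cor22.ord_algebraMap_eq v, hordu₀]
    rw [h2] at h1
    have hne : (Ideal.ramificationIdx' v.asIdeal w.asIdeal : ℤ) ≠ 0 := by
      exact_mod_cast Ideal.IsDedekindDomain.ramificationIdx'_ne_zero_of_liesOver w.asIdeal v.ne_bot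
    have h3 : (Ideal.ramificationIdx' v.asIdeal w.asIdeal : ℤ) * (qParamOrd T.E v : ℤ) =
        (Ideal.ramificationIdx' v.asIdeal w.asIdeal : ℤ) * ((Ideal.ramificationIdx' u₀.asIdeal v.asIdeal : ℤ) * h) := by
      linarith
    exact mul_left_cancel₀ hne h3
  have hq' : qParamOrd T.E v = Ideal.ramificationIdx' u₀.asIdeal v.asIdeal * h := by exact_mod_cast hq
  -- `e(v|p) = e(v|u₀)`
  have hramu₀ : ramIdx (ratPoint q).F u₀ = 1 := by
    rw [ramIdx_eq]; exact Literature.NumberTheory.EllipticCurves.Fisher2016.ramificationIdx_int_rat_eq_one u₀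
  have hramv : ramIdx T.F v = Ideal.ramificationIdx' u₀.asIdeal v.asIdeal := by
    rw [ramIdx_eq, ThetaData.absRamificationIdx_eq_ramIdx_mul (F := (ratPoint q).F) v, hv_under, hramu₀, one_mul]
  have he1 : 1 ≤ Ideal.ramificationIdx' u₀.asIdeal v.asIdeal :=
    Nat.one_le_iff_ne_zero.2 (Ideal.IsDedekindDomain.ramificationIdx'_ne_zero_of_liesOver v.asIdeal u₀.ne_bot)
  -- `[K:ℚ] ≤ 184320·l⁴ ≤ (30l)⁴ ≤ p⁴`, so `log_p [K:ℚ] ≤ 4`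
  have hfin : finrank ℚ T.K ≤ (pp : ℕ) ^ 4 := by
    refine T.finrank_rat_K_le_ratPoint.trans ?_
    calc 184320 * l ^ 4 ≤ (30 * l) ^ 4 := by nlinarith [Nat.zero_le (l ^ 4)]
      _ ≤ (pp : ℕ) ^ 4 := Nat.pow_le_pow_left h30.le 4
  have hpR : (1 : ℝ) < ((pp : ℕ) : ℝ) := by exact_mod_cast pp.2.one_lt
  have hfinpos : (0 : ℝ) < (finrank ℚ T.K : ℝ) := by exact_mod_cast Module.finrank_pos
  have hlogb : Real.logb (pp : ℕ) (finrank ℚ T.K) ≤ 4 := by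
    rw [Real.logb_le_iff_le_rpow hpR hfinpos]
    have : ((finrank ℚ T.K : ℕ) : ℝ) ≤ (((pp : ℕ) ^ 4 : ℕ) : ℝ) := by exact_mod_cast hfin
    simpa [Real.rpow_natCast] using this
  -- the heavy inequality of `not_hStar_pilotDataOfK_of_heavy_top`
  refine not_hStar_pilotDataOfK_of_heavy_top T.D hlog pp (by have := pp.2.two_le; omega) x₀ hx₀S ?_
  change 4 * (l : ℝ) * (ramIdx T.F v : ℝ) * (6 + 2 * Real.logb (pp : ℕ) (finrank ℚ T.K)) ≤ ((l : ℝ) - 3) * (qParamOrd T.E v : ℝ)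
  rw [hramv, hq']
  set e := Ideal.ramificationIdx' u₀.asIdeal v.asIdeal with hedef
  have heR : (1 : ℝ) ≤ (e : ℝ) := by exact_mod_cast he1
  have hlR : (5 : ℝ) ≤ (l : ℝ) := by exact_mod_cast hl5
  have hineqR : (56 : ℝ) * l ≤ ((l : ℝ) - 3) * h := by
    have h' : ((56 * l : ℕ) : ℝ) ≤ (((l - 3) * h : ℕ) : ℝ) := by exact_mod_cast hineq
    rw [Nat.cast_mul, Nat.cast_mul, Nat.cast_sub (by omega)] at h'
    simpa using h'
  have h14 : 6 + 2 * Real.logb (pp : ℕ) (finrank ℚ T.K) ≤ 14 := by linarith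
  push_cast
  calc 4 * (l : ℝ) * (e : ℝ) * (6 + 2 * Real.logb (pp : ℕ) (finrank ℚ T.K))
      ≤ 4 * (l : ℝ) * (e : ℝ) * 14 := mul_le_mul_of_nonneg_left h14 (by positivity)
    _ = (56 * (l : ℝ)) * e := by ring
    _ ≤ (((l : ℝ) - 3) * h) * e := mul_le_mul_of_nonneg_right hineqR (by positivity)
    _ = ((l : ℝ) - 3) * ((e : ℝ) * h) := by ring

/-- **Every genuine Θ-volume datum over `(ratPoint λ_{r,32}, l)` has its `K`-level pilot datum OUTSIDE Σ₃** for primes `l ≥ 24` and `r > 30·l`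
(pole of order `64` at `r`; `56l ≤ 64(l−3)`). [cite: Mochizuki2012, IUTchI Def. 3.1 (b)(c) pp. 61–62; IUTchIV Prop. 1.2 p. 10, Prop. 1.3 p. 12]
[claim: Mochizuki2012, status: disputed] -/
theorem not_hStar_of_datum {r l : ℕ} (T : ThetaVolumeDatumAt (ratPoint (((r ^ 32 : ℕ) : ℚ) / ((r ^ 32 + 1 : ℕ) : ℚ))) l)
    (hl : l.Prime) (hl24 : 24 ≤ l) (hr : r.Prime) (h30 : 30 * l < r) :
    letI := T.instFieldF; letI := T.instNumberFieldF; letI := T.instAlgebraF; letI := T.instFieldK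
    letI := T.instNumberFieldK; letI := T.instAlgebraK; letI := T.instFieldFbar; letI := T.instAlgebraFbar
    letI := T.instAlgebraKFbar; letI := T.instIsElliptic
    ∀ (logv : PadicLogs T.K) (hlog : LogvAnalytic logv), ¬ HStar (pilotDataOfK T.D T.K) hlog :=
  not_hStar_ratPoint_of_pole T (mem_UP r 32 hr.pos) hl ⟨r, hr⟩ (by change r ≠ 2; omega) (by change r ≠ 3; omega)
    (by change r ≠ 5; omega) (by change r ≠ l; omega) h30 (h := 64) (by norm_num)
    (fun u hu => by rw [ord_jInv_of_natGenerator_eq r 32 hr (by omega) (by norm_num) u hu]) (by omega)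

end Out

/-! ## §3. «NOT UNIFORMLY» for row 3: no `l₀` serves all genuine data -/

/-- **Q3 (row 3), UNIFORM READING — REFUTED UNCONDITIONALLY.** There is NO `l₀` such that for every level `l ≥ l₀`, every curve `(F, E_F)`, every
[IUTchI] Def. 3.1 datum `D` of level `l` over it and every analytic logarithm family, the `K`-level pilot datum `pilotDataOfK D K` satisfies the typed
hull-capacity hypothesis H⋆₃ (`RHHullCapacityNecessaryTyped.HStar`, i.e. lies in Σ₃). Witness at a given `l₀`: a prime `l ≡ 3 (mod 4)`,
`l > max(l₀, 2560)` (Dirichlet), a prime `r ∈ (30l, 60l]` (Bertrand), the point `λ_{r,32} = r³²/(r³²+1)` — admissible with (P2) (`64 < l`,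
`r³² + 1 < 3^l`), (P5), (P6) (§1) — a genuine Θ-volume datum over `(ratPoint λ_{r,32}, l)` by `ThetaPartII.stub_thetaData`, outside Σ₃ by §2
(for the analytic family `analyticLogv`, and indeed for every one). Compare g0's `lTailSigma3_holds` (p470687): every FIXED curve is inside Σ₃ for
`l ≥ l₀(E)` — so `l₀(E)` is unbounded over curves («Q3 3: YES PER CURVE, NOT UNIFORMLY», both halves theorems). No abc claim; no side taken on
[IUTchIII] Cor. 3.12; H⋆₃ = row 3's hypothesis vocabulary; refuted-as-typed ≠ refuted-in-print.
[cite: Mochizuki2012, IUTchI Def. 3.1 (b)(c) pp. 61–62; IUTchIV Prop. 1.2 (i)(ii) p. 10, Prop. 1.3 p. 12, Cor. 2.2 (ii) proof (P2)(P5)(P6)(P7) pp. 45–46]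
[cite: Mazur1978, §6 Prop. 6.3 (1) p. 153] [claim: Mochizuki2012, status: disputed] -/
theorem not_exists_uniform_l0_hStar :
    ¬ ∃ l₀ : ℕ, ∀ l : ℕ, l₀ ≤ l →
      ∀ (F : Type) [Field F] [NumberField F] (E : WeierstrassCurve F) [E.IsElliptic]
        (K Fbar : Type) [Field K] [NumberField K] [Algebra F K] [Field Fbar] [Algebra F Fbar] [Algebra K Fbar]
        (Pb : BadPlacePredicates K) (D : InitialThetaData F K Fbar E l Pb) (logv : PadicLogs K) (hlog : LogvAnalytic logv),
        HStar (pilotDataOfK D K) hlog := by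
  rintro ⟨l₀, hyp⟩
  -- a prime `l ≡ 3 (mod 4)` beyond `max l₀ 2560`
  obtain ⟨l, hlgt, hl, hmod⟩ := Nat.forall_exists_prime_gt_and_modEq (max l₀ 2560) (q := 4) (a := 3) (by norm_num) (by norm_num)
  have hl0 : l₀ ≤ l := le_trans (le_max_left _ _) hlgt.le
  have hl2560 : 2560 ≤ l := le_trans (le_max_right _ _) hlgt.le
  have hmod' : l % 4 = 3 := hmod
  -- a prime `r` with `30·l < r ≤ 60·l`
  obtain ⟨r, hr, h30, h60⟩ := Nat.exists_prime_lt_and_le_two_mul (30 * l) (by omega)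
  have hr2 : r ≠ 2 := by omega
  have hr5 : r ≠ 5 := by omega
  have hrl : r ≠ l := by omega
  have h3l : r ^ 32 + 1 < 3 ^ l := pow_succ_lt_three_pow (n := 32) (by norm_num) (by omega) (by omega)
  have hln : ¬ l ∣ 2 * 32 := by intro h; have := Nat.le_of_dvd (by norm_num) h; omega
  -- a genuine Θ-volume datum at `(ratPoint λ_{r,32}, l)`
  obtain ⟨T⟩ := ThetaPartII.stub_thetaData (ratPoint (((r ^ 32 : ℕ) : ℚ) / ((r ^ 32 + 1 : ℕ) : ℚ))) (mem_UP r 32 hr.pos) l hl (by omega)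
    (admitsCore r 32 hr (by omega) (by norm_num)) (condP2 r 32 hr hr2 (by norm_num) (by norm_num) hl (by omega) h3l)
    (condP5 r 32 hr hr2 (by norm_num) hl hrl) (condP6 r 32 hr hr2 hr5 (by norm_num) (by norm_num) hl (by omega) hmod' hrl hln)
  letI := T.instFieldF; letI := T.instNumberFieldF; letI := T.instAlgebraF; letI := T.instFieldK
  letI := T.instNumberFieldK; letI := T.instAlgebraK; letI := T.instFieldFbar; letI := T.instAlgebraFbar
  letI := T.instAlgebraKFbar; letI := T.instIsElliptic
  exact not_hStar_of_datum T hl (by omega) hr h30 (analyticLogv T.K) logvAnalytic_analyticLogv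
    (hyp l hl0 T.F T.E T.K T.Fbar T.Pb T.D (analyticLogv T.K) logvAnalytic_analyticLogv)

/-- **Bookkeeping against the per-curve target**: the statement refuted above implies g0's per-curve `LTailSigma3 F E` for every curve
(quantifier order `∃ l₀ ∀ curves` vs `∀ curve ∃ l₀`); the converse is what fails. [folklore] -/
theorem lTailSigma3_of_forall
    (h : ∃ l₀ : ℕ, ∀ l : ℕ, l₀ ≤ l →
      ∀ (F : Type) [Field F] [NumberField F] (E : WeierstrassCurve F) [E.IsElliptic]
        (K Fbar : Type) [Field K] [NumberField K] [Algebra F K] [Field Fbar] [Algebra F Fbar] [Algebra K Fbar]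
        (Pb : BadPlacePredicates K) (D : InitialThetaData F K Fbar E l Pb) (logv : PadicLogs K) (hlog : LogvAnalytic logv),
        HStar (pilotDataOfK D K) hlog)
    (F : Type) [Field F] [NumberField F] (E : WeierstrassCurve F) [E.IsElliptic] : LTailSigma3 F E := by
  obtain ⟨l₀, h⟩ := h
  exact ⟨l₀, fun l hl K Fbar _ _ _ _ _ _ Pb D logv hlog => h l hl F E K Fbar Pb D logv hlog⟩

end UniformWitnessPow

end Summit.ABC.IUTFork.Repair.RH.Q3LTailSigma8

end
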